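import Summits.MatrixMultiplication.MatrixMultiplication.Theorems.SoloInformedTwistedMatchingsEffectiveExponent
import Summits.MatrixMultiplication.MatrixMultiplication.Theorems.SoloInformedTranslationSchemes
import HarnessLib

/-!
# Effective Theorem B″ at scheme level for every bounded exponent `m = p^E m'`, `p ∤ m'`

Solo-informed seat (MatrixMultiplication), gen 101; sharpest-statement §2y(8). The capstone of the effective
form: under the level conditions at `(p, E, u, c)`, a Cohn–Umans (CU13 Def. 11/12) realization of
`⟨3N,3N,3N⟩` in a translation scheme `𝒮(S, M₀)` over a finite abelian group `S` with `g^{p^E m'} = 1`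
(`M₀ ≤ Aut S` arbitrary) forces `N² e^{-4√(log N)} ≤ 3 · t · a^c` where `|S| = a · t`, `a = |S_p|`
(`a` a power of `p`, `gcd(p,t) = 1`) and `a · t ≤ |C| · |M₀|` (`|C|` = number of orbit labels `≥` rank).
Unconditional instance: exponent `2m'`, `m'` odd, `c = 23/25`.
References: CohnUmans2013 (arXiv:1207.6528) Def. 11/12, §5; BCCGNSU17 (arXiv:1605.06702) §4.
-/

noncomputable section

open scoped BigOperators
open Finset Literature.Combinatorics.Additive

namespace Summit.MatrixMultiplication.MatrixMultiplication.Theorems.TwistedSliceRank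

section EffectiveExponentHeadline

/-- **Realization form, exponent `p^E m'`.** Level conditions at `(p,E,u,c)` and a CU13 Def. 12
realization of `⟨3N,3N,3N⟩` by the twisted triangle predicate of finitely many automorphism pairs of a finite
abelian `S` with `g^{p^E m'} = 1` give `|S| = a t`, `a` a power of `p`, `gcd(p,t) = 1`, and
`N² e^{-4√(log N)} ≤ 3 t a^c`. [this work] -/
theorem realization_effective_of_exponent (p : ℕ) [hp : Fact p.Prime] (E m' : ℕ)
    (hm' : Nat.Coprime p m') (u c : ℝ) (hu0 : 0 < u) (hu1 : u ≤ 1)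
    (hθ : ∀ s : ℕ, s < E →
      u ^ (-(((p - 1 : ℕ) : ℝ)) * ((p : ℝ) + 1) ^ s / 3) *
        ∑ j : Fin p, u ^ (((j : ℕ) : ℝ) * ((p : ℝ) + 1) ^ s) ≤ (p : ℝ) ^ c)
    (S : Type) [CommGroup S] [Fintype S] [DecidableEq S]
    (hexpS : ∀ g : S, g ^ (p ^ E * m') = 1) (σ : Type) [Fintype σ] (φ ψ : σ → S ≃* S) (N : ℕ)
    (α β γ : Fin (3 * N) × Fin (3 * N) → S)
    (hreal : ∀ x y z : Fin (3 * N) × Fin (3 * N),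
      (∃ s : σ, α x * φ s (β y) * ψ s (γ z) = 1) ↔ (y.1 = x.2 ∧ z = (y.2, x.1))) :
    ∃ a t : ℕ, Fintype.card S = a * t ∧ Nat.Coprime p t ∧ (∃ k : ℕ, a = p ^ k) ∧
      ((N : ℝ) ^ 2 * Real.exp (-4 * Real.sqrt (Real.log N))) ≤ 3 * (t : ℝ) * (a : ℝ) ^ c := by
  obtain ⟨T, hTN, hTcard, hT⟩ := rothNumberNat_spec N
  obtain ⟨a, b, d, -, hind⟩ := threeAPFree_inducedMatching hT hTN
  have hmatch : ∀ i j l : ↥T × Fin N,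
      (∃ s : σ, α (a i, b i) * φ s (β (b j, d j)) * ψ s (γ (d l, a l)) = 1) ↔ (i = j ∧ j = l) := by
    intro i j l
    rw [hreal (a i, b i) (b j, d j) (d l, a l)]
    constructor
    · rintro ⟨h1, h2⟩
      simp only [Prod.mk.injEq] at h2
      exact hind i j l h1 h2.1 h2.2
    · rintro ⟨rfl, rfl⟩
      exact ⟨rfl, rfl⟩
  obtain ⟨aa, tt, hSt, hcop, hk, h⟩ := twistedMatching_card_le_effective_of_exponent p E m' hm' u c
    hu0 hu1 hθ S hexpS σ φ ψ (↥T × Fin N)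
    (fun i => α (a i, b i)) (fun j => β (b j, d j)) (fun l => γ (d l, a l)) hmatch
  refine ⟨aa, tt, hSt, hcop, hk, ?_⟩
  have hcard : Fintype.card (↥T × Fin N) = rothNumberNat N * N := by
    rw [Fintype.card_prod, Fintype.card_coe, hTcard, Fintype.card_fin]
  rw [hcard] at h
  push_cast at h
  have hB : (N : ℝ) * Real.exp (-4 * Real.sqrt (Real.log N)) ≤ rothNumberNat N :=
    Behrend.roth_lower_bound
  have hN : (0 : ℝ) ≤ N := Nat.cast_nonneg N
  calc (N : ℝ) ^ 2 * Real.exp (-4 * Real.sqrt (Real.log N))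
      = ((N : ℝ) * Real.exp (-4 * Real.sqrt (Real.log N))) * N := by ring
    _ ≤ (rothNumberNat N : ℝ) * N := mul_le_mul_of_nonneg_right hB hN
    _ ≤ _ := h

/-- **Translation-scheme form, exponent `p^E m'`: the `p`-part of `|S|` pays the saving.** Level
conditions at `(p,E,u,c)`; a realization of `⟨3N,3N,3N⟩` in `𝒮(S, M₀)` (CU13 Def. 11/12), `S` finite
abelian with `g^{p^E m'} = 1`, `M₀ ≤ Aut S` arbitrary, gives `|S| = a t` (`a = |S_p|`, `gcd(p,t) = 1`),
`N² e^{-4√(log N)} ≤ 3 t a^c`, and `a t ≤ |C|·|M₀|`. [this work] -/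
theorem translationScheme_effective_of_exponent (p : ℕ) [hp : Fact p.Prime] (E m' : ℕ)
    (hm' : Nat.Coprime p m') (u r : ℝ) (hu0 : 0 < u) (hu1 : u ≤ 1)
    (hθ : ∀ s : ℕ, s < E →
      u ^ (-(((p - 1 : ℕ) : ℝ)) * ((p : ℝ) + 1) ^ s / 3) *
        ∑ j : Fin p, u ^ (((j : ℕ) : ℝ) * ((p : ℝ) + 1) ^ s) ≤ (p : ℝ) ^ r)
    (S : Type) [CommGroup S] [Fintype S] [DecidableEq S]
    (hexpS : ∀ g : S, g ^ (p ^ E * m') = 1) (M₀ : Subgroup (MulAut S)) [Fintype M₀]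
    (C : Type) [Fintype C] [DecidableEq C] (c : S → C)
    (hc : ∀ g h : S, c g = c h ↔ ∃ φ : M₀, (φ : MulAut S) g = h) (N : ℕ)
    (A B Γ : Fin (3 * N) × Fin (3 * N) → C)
    (hreal : ∀ x y z : Fin (3 * N) × Fin (3 * N),
      (∃ g h l : S, c g = A x ∧ c h = B y ∧ c l = Γ z ∧ g * h * l = 1) ↔
        (y.1 = x.2 ∧ z = (y.2, x.1))) :
    ∃ a t : ℕ, Fintype.card S = a * t ∧ Nat.Coprime p t ∧ (∃ k : ℕ, a = p ^ k) ∧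
      ((N : ℝ) ^ 2 * Real.exp (-4 * Real.sqrt (Real.log N))) ≤ 3 * (t : ℝ) * (a : ℝ) ^ r ∧
      a * t ≤ Fintype.card C * Fintype.card M₀ := by
  have hSC : Fintype.card S ≤ Fintype.card C * Fintype.card M₀ := card_le_card_labels_mul M₀ c hc
  suffices h : ∃ a t : ℕ, Fintype.card S = a * t ∧ Nat.Coprime p t ∧ (∃ k : ℕ, a = p ^ k) ∧
      ((N : ℝ) ^ 2 * Real.exp (-4 * Real.sqrt (Real.log N))) ≤ 3 * (t : ℝ) * (a : ℝ) ^ r by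
    obtain ⟨a, t, h1, h2, h3, h4⟩ := h
    exact ⟨a, t, h1, h2, h3, h4, h1 ▸ hSC⟩
  rcases Nat.eq_zero_or_pos N with hN | hN
  · subst hN
    exact realization_effective_of_exponent p E m' hm' u r hu0 hu1 hθ S hexpS (↥M₀ × ↥M₀)
      (fun s => (s.1 : MulAut S)) (fun s => (s.2 : MulAut S)) 0 (fun _ => 1) (fun _ => 1)
      (fun _ => 1) (fun x => absurd x.1.isLt (by omega))
  have w : Fin (3 * N) := ⟨0, by omega⟩
  have hA : ∀ x, ∃ g : S, c g = A x := fun x => by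
    obtain ⟨g, h, l, hg, -, -, -⟩ := (hreal x (x.2, w) (w, x.1)).2 ⟨rfl, rfl⟩
    exact ⟨g, hg⟩
  have hB : ∀ y, ∃ g : S, c g = B y := fun y => by
    obtain ⟨g, h, l, -, hh, -, -⟩ := (hreal (w, y.1) y (y.2, w)).2 ⟨rfl, rfl⟩
    exact ⟨h, hh⟩
  have hΓ : ∀ z, ∃ g : S, c g = Γ z := fun z => by
    obtain ⟨g, h, l, -, -, hl, -⟩ := (hreal (z.2, w) (w, z.1) z).2 ⟨rfl, Prod.ext rfl rfl⟩
    exact ⟨l, hl⟩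
  choose α hα using hA
  choose β hβ using hB
  choose γ hγ using hΓ
  refine realization_effective_of_exponent p E m' hm' u r hu0 hu1 hθ S hexpS (↥M₀ × ↥M₀)
    (fun s => (s.1 : MulAut S)) (fun s => (s.2 : MulAut S)) N α β γ (fun x y z => ?_)
  rw [← hreal x y z]
  exact (triangle_iff_twisted M₀ c hc (hα x) (hβ y) (hγ z)).symm

/-- **Unconditional instance: exponent `2m'`, `m'` odd.** A realization of `⟨3N,3N,3N⟩` in `𝒮(S, M₀)`,
`S` finite abelian with `g^{2m'} = 1`, gives `|S| = a t` with `a = |S_2|`, `t` odd,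
`N² e^{-4√(log N)} ≤ 3 t a^{23/25}` and `a t ≤ |C|·|M₀|`. [this work] -/
theorem translationScheme_exp_two_mul_odd (m' : ℕ) (hm' : Odd m') (S : Type) [CommGroup S]
    [Fintype S] [DecidableEq S] (hexpS : ∀ g : S, g ^ (2 * m') = 1)
    (M₀ : Subgroup (MulAut S)) [Fintype M₀] (C : Type) [Fintype C] [DecidableEq C] (c : S → C)
    (hc : ∀ g h : S, c g = c h ↔ ∃ φ : M₀, (φ : MulAut S) g = h) (N : ℕ)
    (A B Γ : Fin (3 * N) × Fin (3 * N) → C)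
    (hreal : ∀ x y z : Fin (3 * N) × Fin (3 * N),
      (∃ g h l : S, c g = A x ∧ c h = B y ∧ c l = Γ z ∧ g * h * l = 1) ↔
        (y.1 = x.2 ∧ z = (y.2, x.1))) :
    ∃ a t : ℕ, Fintype.card S = a * t ∧ Nat.Coprime 2 t ∧ (∃ k : ℕ, a = 2 ^ k) ∧
      ((N : ℝ) ^ 2 * Real.exp (-4 * Real.sqrt (Real.log N))) ≤
        3 * (t : ℝ) * (a : ℝ) ^ (23 / 25 : ℝ) ∧
      a * t ≤ Fintype.card C * Fintype.card M₀ := by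
  haveI : Fact (Nat.Prime 2) := ⟨Nat.prime_two⟩
  refine translationScheme_effective_of_exponent 2 1 m' (Nat.Coprime.symm hm'.coprime_two_right)
    (1 / 2) (23 / 25) (by norm_num) (by norm_num) ?_ S (fun g => by simpa using hexpS g)
    M₀ C c hc N A B Γ hreal
  intro s hs
  interval_cases s
  rw [Fin.sum_univ_two, Fin.val_zero, Fin.val_one]
  norm_num
  rw [one_div (2 : ℝ), Real.inv_rpow (by norm_num), Real.rpow_neg (by norm_num), inv_inv]
  have h75 : ((2 : ℝ) ^ ((1 : ℝ) / 3) * (3 / 2)) ^ (75 : ℕ) ≤ ((2 : ℝ) ^ ((23 : ℝ) / 25)) ^ (75 : ℕ) := by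
    rw [mul_pow, ← Real.rpow_natCast ((2 : ℝ) ^ ((1 : ℝ) / 3)) 75,
      ← Real.rpow_mul (by norm_num), ← Real.rpow_natCast ((2 : ℝ) ^ ((23 : ℝ) / 25)) 75,
      ← Real.rpow_mul (by norm_num),
      show ((1 : ℝ) / 3 * ((75 : ℕ) : ℝ)) = ((25 : ℕ) : ℝ) by norm_num,
      show ((23 : ℝ) / 25 * ((75 : ℕ) : ℝ)) = ((69 : ℕ) : ℝ) by norm_num,
      Real.rpow_natCast, Real.rpow_natCast]
    norm_num
  exact le_of_pow_le_pow_left₀ (by norm_num) (by positivity) h75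

end EffectiveExponentHeadline

end Summit.MatrixMultiplication.MatrixMultiplication.Theorems.TwistedSliceRank
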